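import Summits.QuantumFields.BalabanUV.T4Continuum.Support.NE7LawLevelOneStepVariance

/-!
# NE7, ROAD P4 (law-level): NODE Q.old, item (k10a) — THE TWO-STAGE BACKWARD STEP: a three-level Pythagoras
# (law of total variance along `m₂ ≤ m_mid ≤ mΩ`) and the composition of two Poincaré profiles through a smearing bound

(Cell `pub-balaban`, sub-cell `t4`, binder row NE7 = node U5, co-owner #4 `b2b-balaban-t4-ne7-p4`, gen 3; skeleton
`HOME/t4/skeletons/NE7-t4-ne7-p4.md` v1.9 §2 NODE Q.old; `HOME/t4/b2b-balaban-t4-ne7-p4/g3/PROOF-QV-NE7-P4.md` v1.1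
§6 (6a) «resampling stage»: the layer-`j` backward kernel of the (ℝT)-chain is TWO-stage — the level's resampling
noise, then the T-fibre — and the two stages compose by an exact law of total variance, the second stage needing the
Lipschitz SMEARING of the test function by the first (a (QL)-type input).  This file types exactly that.)

HONEST FRAMING (T4-DAG PAGE 1).  Rung (B)+1 on ONE FIXED finite four-torus, CONDITIONAL on `BetaPertH` and the nine
spine estimates (0/9 proved); NOT infinite volume, NOT a mass gap, NOT the Clay problem.  NE7 is NOT PRINTED and NOT
proved here.  Pure [folklore] measure theory over plain data, sorry-free; nothing of the audited series is asserted;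
NOT summit progress.

WHAT IS PROVED.
* `integral_sq_sub_condExp_eq_add_tower` — THREE-LEVEL PYTHAGORAS: for `m₂ ≤ m_mid ≤ mΩ` and a bounded strongly
  measurable `g`, `∫ (g − μ[g|m₂])² = ∫ (g − μ[g|m_mid])² + ∫ (μ[g|m_mid] − μ[g|m₂])²` (the law of total variance,
  integrated; from the road's `integral_sq_condExp_eq_sq_sub_add_sq` along the antitone family `mΩ, m_mid, m₂`).
* `exists_bounded_version_condExp` — a bounded, `m`-strongly-measurable VERSION of `μ[g|m]` (clamp at the bound).
* `integral_sq_sub_condExp_tower_le` — budgets add: `∫ (g − μ[g|m_mid])² ≤ V₁`, `∫ (h − μ[h|m₂])² ≤ V₂` for some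
  bounded `m_mid`-version `h` of `μ[g|m_mid]` ⇒ `∫ (g − μ[g|m₂])² ≤ V₁ + V₂`.
* `poincare_two_stage` — COMPOSITION OF PROFILES: `PoincareProfile μ m₁ m_mid C₁ sites D₁` (DICTIONARY: the
  resampling stage, Efron–Stein in the noise coordinates) and `PoincareProfile μ m_mid m₂ C₂ sites D₂` (the T-fibre
  stage = leaf (QV), `PROOF-QV` §2) and a SMEARING bound `Σ_b (D₂ b h)² ≤ Θ·Σ_b (D₁ b g)²` for every bounded
  `m_mid`-version `h` of `μ[g|m_mid]` (DICTIONARY: (QL)-type Lipschitz dependence of the backward resampling law on the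
  post-resampling field, `PROOF-QV` §6 (6a)) give `∫ (g − μ[g|m₂])² ≤ (C₁ + C₂·Θ)·Σ_b (D₁ b g)²` for bounded
  `m₁`-measurable `g` — i.e. the layer's `PoincareProfile`-type bound with constant `C₁ + C₂Θ`.
-/

noncomputable section

open MeasureTheory Finset
open scoped BigOperators

namespace Summit.QuantumFields.BalabanUV.T4Continuum.NE7LawLevel

open Literature.MathematicalPhysics.QuantumFieldTheory.Balaban1983to89
open Literature.MathematicalPhysics.QuantumFieldTheory.Balaban1983to89.T4MeanChannel

variable {Ω : Type*} {mΩ : MeasurableSpace Ω} {μ : Measure Ω}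

/-- **THREE-LEVEL PYTHAGORAS (law of total variance, integrated).**  For `m₂ ≤ m_mid ≤ mΩ` and a bounded strongly
measurable `g` on a finite measure space:
`∫ (g − μ[g|m₂])² = ∫ (g − μ[g|m_mid])² + ∫ (μ[g|m_mid] − μ[g|m₂])²`. [folklore] -/
theorem integral_sq_sub_condExp_eq_add_tower [IsFiniteMeasure μ] {m_mid m₂ : MeasurableSpace Ω}
    (hmid : m_mid ≤ mΩ) (h₂ : m₂ ≤ m_mid) {g : Ω → ℝ} (hgm : StronglyMeasurable[mΩ] g) {B : ℝ}
    (hgb : ∀ ω, |g ω| ≤ B) :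
    ∫ ω, (g ω - μ[g|m₂] ω) ^ 2 ∂μ =
      ∫ ω, (g ω - μ[g|m_mid] ω) ^ 2 ∂μ + ∫ ω, (μ[g|m_mid] ω - μ[g|m₂] ω) ^ 2 ∂μ := by
  -- the three-member antitone family mΩ ⊇ m_mid ⊇ m₂ ⊇ m₂ ⊇ …
  let F : ℕ → MeasurableSpace Ω := fun n => if n = 0 then mΩ else if n = 1 then m_mid else m₂
  have hF0 : F 0 = mΩ := rfl
  have hF1 : F 1 = m_mid := rfl
  have hF2 : F 2 = m₂ := rfl
  have hFle : ∀ j, F j ≤ mΩ := by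
    intro j
    by_cases hj0 : j = 0
    · subst hj0; exact le_rfl
    by_cases hj1 : j = 1
    · subst hj1; exact hmid
    have : F j = m₂ := by simp only [F, if_neg hj0, if_neg hj1]
    rw [this]; exact h₂.trans hmid
  have hF : Antitone F := by
    refine antitone_nat_of_succ_le fun n => ?_
    by_cases hn0 : n = 0
    · subst hn0; exact hmid
    by_cases hn1 : n = 1
    · subst hn1; exact h₂
    have h1 : F n = m₂ := by simp only [F, if_neg hn0, if_neg hn1]
    have h2 : F (n + 1) = m₂ := by
      simp only [F, if_neg (Nat.succ_ne_zero n), if_neg (show n + 1 ≠ 1 by omega)]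
    rw [h1, h2]
  have hgi : Integrable g μ := integrable_of_ae_abs_le hgm.aestronglyMeasurable (ae_of_all μ hgb)
  -- μ[g | F 0] = μ[g | mΩ] = g
  have h0 : μ[g|F 0] = g := by rw [hF0]; exact condExp_of_stronglyMeasurable (m := mΩ) le_rfl hgm hgi
  -- three Pythagoras identities along F
  have e01 := integral_sq_condExp_eq_sq_sub_add_sq (μ := μ) hF hFle hgb 0 1
  have e12 := integral_sq_condExp_eq_sq_sub_add_sq (μ := μ) hF hFle hgb 1 1
  have e02 := integral_sq_condExp_eq_sq_sub_add_sq (μ := μ) hF hFle hgb 0 2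
  simp only [Nat.zero_add] at e01 e02
  rw [show (1 : ℕ) + 1 = 2 from rfl] at e12
  rw [h0, hF1] at e01
  rw [hF1, hF2] at e12
  rw [h0, hF2] at e02
  linarith

/-- A bounded, `m`-strongly-measurable VERSION of a conditional expectation of a bounded function: clamp `μ[g|m]` to
`[−B, B]`. [folklore] -/
theorem exists_bounded_version_condExp {m : MeasurableSpace Ω} {g : Ω → ℝ} {B : ℝ} (hgb : ∀ ω, |g ω| ≤ B) :
    ∃ h : Ω → ℝ, StronglyMeasurable[m] h ∧ (∀ ω, |h ω| ≤ B) ∧ h =ᵐ[μ] μ[g|m] := by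
  refine ⟨(fun _ => -B) ⊔ ((fun _ => B) ⊓ μ[g|m]), ?_, ?_, ?_⟩
  · have hc1 : StronglyMeasurable[m] fun _ : Ω => -B := stronglyMeasurable_const
    have hc2 : StronglyMeasurable[m] fun _ : Ω => B := stronglyMeasurable_const
    have hce : StronglyMeasurable[m] (μ[g|m]) := stronglyMeasurable_condExp
    exact hc1.sup (hc2.inf hce)
  · intro ω
    have hB0 : 0 ≤ B := (abs_nonneg _).trans (hgb ω)
    simp only [Pi.sup_apply, Pi.inf_apply]
    rw [abs_le]
    exact ⟨le_sup_left, sup_le (by linarith) inf_le_left⟩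
  · filter_upwards [ae_abs_condExp_le (μ := μ) (m := m) hgb] with ω hω
    rw [abs_le] at hω
    simp only [Pi.sup_apply, Pi.inf_apply]
    rw [inf_eq_right.mpr hω.2, sup_eq_right.mpr hω.1]

/-- **BUDGETS ADD ALONG THE TOWER.**  If `∫ (g − μ[g|m_mid])² ≤ V₁` and, for SOME bounded `m_mid`-strongly-measurable
version `h` of `μ[g|m_mid]`, `∫ (h − μ[h|m₂])² ≤ V₂`, then `∫ (g − μ[g|m₂])² ≤ V₁ + V₂`. [folklore] -/
theorem integral_sq_sub_condExp_tower_le [IsFiniteMeasure μ] {m_mid m₂ : MeasurableSpace Ω}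
    (hmid : m_mid ≤ mΩ) (h₂ : m₂ ≤ m_mid) {g : Ω → ℝ} (hgm : StronglyMeasurable[mΩ] g) {B : ℝ}
    (hgb : ∀ ω, |g ω| ≤ B) {V₁ V₂ : ℝ} (hV₁ : ∫ ω, (g ω - μ[g|m_mid] ω) ^ 2 ∂μ ≤ V₁)
    {h : Ω → ℝ} (hh : h =ᵐ[μ] μ[g|m_mid]) (hV₂ : ∫ ω, (h ω - μ[h|m₂] ω) ^ 2 ∂μ ≤ V₂) :
    ∫ ω, (g ω - μ[g|m₂] ω) ^ 2 ∂μ ≤ V₁ + V₂ := by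
  rw [integral_sq_sub_condExp_eq_add_tower hmid h₂ hgm hgb]
  refine add_le_add hV₁ (le_of_eq_of_le ?_ hV₂)
  -- ∫ (μ[g|m_mid] − μ[g|m₂])² = ∫ (h − μ[h|m₂])², the integrands agreeing a.e.
  haveI : SigmaFinite (μ.trim (h₂.trans hmid)) := inferInstance
  have htow : μ[μ[g|m_mid] | m₂] =ᵐ[μ] μ[g|m₂] := condExp_condExp_of_le h₂ hmid
  have hcong : μ[h|m₂] =ᵐ[μ] μ[μ[g|m_mid] | m₂] := condExp_congr_ae hh
  refine integral_congr_ae ?_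
  filter_upwards [hh, htow, hcong] with ω h1 h2 h3
  rw [h1, h3, h2]

/-- **COMPOSITION OF TWO POINCARÉ PROFILES THROUGH A SMEARING BOUND** (the two-stage backward step of the road's chain:
resampling stage `m₁ → m_mid`, T-fibre stage `m_mid → m₂`).  Hypotheses: the two profiles; `m₂ ≤ m_mid ≤ m₁ ≤ mΩ`;
`g` bounded and `m₁`-strongly-measurable; and the SMEARING bound — for every bounded `m_mid`-strongly-measurable
version `h` of `μ[g|m_mid]`, `Σ_b (D₂ b h)² ≤ Θ·Σ_b (D₁ b g)²` (DICTIONARY: the first stage's backward law depends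
on the coordinates in a Lipschitz way, a (QL)-type input; `0 ≤ Θ`).  Conclusion:
`∫ (g − μ[g|m₂])² ≤ (C₁ + C₂·Θ)·Σ_b (D₁ b g)²`. [folklore] -/
theorem poincare_two_stage [IsFiniteMeasure μ] {β : Type*} {m₁ m_mid m₂ : MeasurableSpace Ω}
    {C₁ C₂ : ℝ} {sites : Finset β} {D₁ D₂ : β → (Ω → ℝ) → ℝ}
    (P₁ : PoincareProfile μ m₁ m_mid C₁ sites D₁) (P₂ : PoincareProfile μ m_mid m₂ C₂ sites D₂)
    (hm₁ : m₁ ≤ mΩ) (hmid : m_mid ≤ m₁) (h₂ : m₂ ≤ m_mid) {g : Ω → ℝ} (hgm : StronglyMeasurable[m₁] g)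
    {B : ℝ} (hgb : ∀ ω, |g ω| ≤ B) {Θ : ℝ}
    (hsmear : ∀ h : Ω → ℝ, StronglyMeasurable[m_mid] h → (∀ ω, |h ω| ≤ B) → h =ᵐ[μ] μ[g|m_mid] →
      ∑ b ∈ sites, D₂ b h ^ 2 ≤ Θ * ∑ b ∈ sites, D₁ b g ^ 2) :
    ∫ ω, (g ω - μ[g|m₂] ω) ^ 2 ∂μ ≤ (C₁ + C₂ * Θ) * ∑ b ∈ sites, D₁ b g ^ 2 := by
  obtain ⟨hC₁, -, -, -, hP₁⟩ := P₁
  obtain ⟨hC₂, -, -, -, hP₂⟩ := P₂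
  obtain ⟨h, hhm, hhb, hhae⟩ := exists_bounded_version_condExp (μ := μ) (m := m_mid) hgb
  have hV₁ : ∫ ω, (g ω - μ[g|m_mid] ω) ^ 2 ∂μ ≤ C₁ * ∑ b ∈ sites, D₁ b g ^ 2 := hP₁ g hgm ⟨B, hgb⟩
  have hV₂ : ∫ ω, (h ω - μ[h|m₂] ω) ^ 2 ∂μ ≤ C₂ * ∑ b ∈ sites, D₂ b h ^ 2 := hP₂ h hhm ⟨B, hhb⟩
  have hV₂' : ∫ ω, (h ω - μ[h|m₂] ω) ^ 2 ∂μ ≤ C₂ * (Θ * ∑ b ∈ sites, D₁ b g ^ 2) :=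
    hV₂.trans (mul_le_mul_of_nonneg_left (hsmear h hhm hhb hhae) hC₂)
  have := integral_sq_sub_condExp_tower_le (hmid.trans hm₁) h₂ (hgm.mono hm₁) hgb hV₁ hhae hV₂'
  linarith [this]

end Summit.QuantumFields.BalabanUV.T4Continuum.NE7LawLevel

end
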